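/-
Copyright (c) 2026 the pub-hodgecm-mathlib formalisation cell (harness21).  Prover seat hodgecm-mathlib-K2Liu-p03 (g8), Track B «K2-LIT»,
#184♮ = hLiu418 = `stmt-HodgeConjecture-24832`; socket #41, KIND 1 — (K1a-T) THE SINGULAR TAIL OF RECORD, FILE 2∕2 «THE HEAD» (K1-a♮ line lead K2E5-p16 (g8) WORD #10 (1),
2026-09-05T00:05:44Z; chair K2-lead (g2) VALVE 00:05:02Z (1)(ii); desk GO 00:16:58Z + interface rule): the PRODUCER of ★ p863404 `K2LiuKindOneSingularTermPackage` §2 (ii)'s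
by-value letters `c D P hP Pm hPT HT htail I T q hq A W hsplit` at the record, for every rank-one index `S` and every `h`, WITH WITNESS EQUATIONS (the localFace junction of record).
THEOREMS ONLY (no `def`, no `instance`, no notation, no named-fact hypothesis, no `sorry`).
-/
import Summits.HodgeConjecture.HodgeConjecture.Theorems.K2LiuKindOneSingularTailEuler            -- FILE 1∕2 (this seat): §1 K1 twin of ★ (W1), §2 corner data of record, §3 Σ∏ slice head
import Summits.HodgeConjecture.HodgeConjecture.Theorems.K2LiuRankOneSingularLocalValueCMRecord    -- ★ p863366 (K1a-2d) ED. 3 `exists_finset_forall_integral_conjChar_lambdaLoc_weylDelta_eq_localScalarK1_of_record`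
import Summits.HodgeConjecture.HodgeConjecture.Theorems.K2LiuSiegelEisensteinKindWGlobalIntegrable -- ★ (x-c) `integrable_conj_unipDeltaChar_mul` (★ G1's `hG`)
import HarnessLib

/-!
# Crux `HLiu418`, socket #41, KIND 1 a♮ — (K1a-T) FILE 2∕2 `K2LiuKindOneSingularTailOfRecord`: THE SINGULAR TAIL OF RECORD
# `c₀ • W_S(f_s)(h) = c₀ · [Σ_j A S j s h · ∏_{v∈T S h} W S j v s h] · [ζ^{T₀∪Pm}_{L⁺}(2s) ∕ (ζ^{T₀∪Pm}_{L⁺}(2s+1)·L^{T₀∪Pm}(2s+2, ε_{L∕L⁺}))] · ∏_{v∈D S h} Σ_{k≤mτ S v}(ε_v q_v^{1−2s})^k`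

Cell `hodgecm-mathlib`, crux item hLiu418 = `stmt-HodgeConjecture-24832` (helper lane `--supports … --as helper`, count-neutral), route of record `HCCMUnconditional`;
squad K2 ∕ K2Liu, road `K2_Liu`, socket #41 `sig_K2LiuSiegelEisensteinContinuation`, KIND 1, block K1-a♮.  CONSUMER: ★ p863404 (K2E4-p10 (g10))
`K2LiuKindOneSingularTermPackage.exists_kindOne_singularTermPackage_of_placeLetters`, whose §2 (ii) by-value binder block
`c D P hP Pm hPT HT htail I T q hq A W hsplit` (`(S,h)`-indexed; `T'' ∪ Pm S h`-scalar; the continuations `Ac Gn` NOT here) this file PRODUCES at the record.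

THE SHAPE (FILE 1∕2's three engines composed; [KudlaRallis1994, §2 (2.10)–(2.12)]; [Tan1999, §3, §4 Prop. 4.8]; [Shimura1997, §18.4]).  DATA: the doubled CM datum of rank `2`
(`hdV0 hdW0`), `lam` conjugate-symplectic, `f_s ∈ I_Δ(s, toHeckeCharacter L lam⁻¹)` continuous (`hsec hcont`; the socket's standard family qualifies by `hstd.1.1`), a Haar measure
`νN` on `N_Δ(𝔸)`, a real scalar `c₀` (the consumer's `(∫β)⁻¹`); the Whittaker–Euler data BY VALUE exactly as ★ (W1) `whittakerDelta_eq_kindWPart_mul` (`T₀ νv hνK νinf hσ hmap`, `hχ`;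
`hfac` with the slices `fT T s x := f s (placesEmbed T x)` EXPLICIT as ★ (KW-fac) (2)); the Σ⊗ STRUCTURE of the slices in ★ (KW-fac) `exists_kindW_factorization` (3)'s
PLACE-INDEXED shape (`Finf j s a`, `Fv j v s y`, `hslice` for every `T ⊇ T₀`); per-FACTOR integrability on `{1 < re s}` at EVERY index and point (`hintArch` — the KIND-W
archimedean letter, K2Liu-p11 lineage; `hintLoc` — ★ (iii-fin-int) `integrable_conj_unipDeltaChar_mul_of_isLocalSiegelSection` pays it for smooth local Siegel factors).
* `differentiable_twistedPoly` — the K1-a♮ polynomial of record `Σ_{k≤M}(ε q^{1−2s})^k` is entire (`hP`).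
* **`htail_hsplit_of_record`** — `∃ σc gc T D Pm mτ A W` with: (a) the corner transport `W_S(f_s)(h) = W_{σc(S)E₁₁}(f_s)(gc S·h)` for rank-one `S` (FILE 1 §2); (b) THE WITNESS
  EQUATIONS `A S j s h = ∫ conj ψ_{σc(S)E₁₁}(ι_∞ a)·Finf j s((w_Δ)_∞·a·(gc S·h)_∞) dνinf(T S h)`, `W S j v s h = ∫ conj ψ_{σc(S)E₁₁}(ι_v y)·Fv j v s((w_Δ)_v·y·(gc S·h)_v) dν_v` (the junction of
  record: the localFace producers — LH4-p07 bad∕CM places, ★ p863455 K2E3-p37 good places, (Φ-S1) arch — state `hA`∕`hW` against EXACTLY these integrals); (c) place-set letters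
  `T₀ ⊆ T S h`, `Pm S h ∩ T₀ = ∅` (★ p863404's `hPT` at `T'' := ↑T₀`), `↑T₀ ∪ ↑(Pm S h) = ↑(T S h)`, `D S h ∩ T S h = ∅` — `T S h = kindWFinset (T₀ ∪ T₁(σc S)) (σc(S)E₁₁) (gc S·h)`,
  `T₁` = ★ p863366's exceptional set; (d) `hq` (`q := residueCard`), `hP`; (e) **`htail ∘ hsplit`** on `{1 < re s}` for rank-one `S` — ★ p863404 §2's `htail` with `c S h := c₀`,
  `HT S s h := Σ_j A·∏W` and `hsplit` by `rfl` (`I S h := univ`).  Proof: FILE 1 §2 ∘ FILE 1 §1 (at `T₀ ∪ T₁(σc S)`, `hI` := ★ p863366, `hG` := ★ (x-c)) ∘ FILE 1 §3.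
HONEST LABEL.  Count-neutral helper (the Σ⊗ structure and the two integrability letters enter BY VALUE with named ★∕in-flight payers: ★ (KW-fac) K2E3-p26, ★ (iii-fin-int)
F0P2-p08, `hintArch` K2Liu-p11 lineage); it closes no socket: `HC_CM` is proved only modulo the 7 printed citations (2 remaining named inputs: hLiu418 =
`stmt-HodgeConjecture-24832`, h413 = `stmt-HodgeConjecture-24833`) until rung 0 closes.

## References
* [KudlaRallis1994] S. Kudla, S. Rallis, *A regularized Siegel–Weil formula: the first term identity*, Ann. of Math. 140 (1994): §2 (2.10)–(2.12).
* [Tan1999] V. Tan, *Poles of Siegel Eisenstein series on U(n,n)*, Canad. J. Math. 51 (1999): §3, §4 Prop. 4.8.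
* [Shimura1997] G. Shimura, *Euler Products and Eisenstein Series*, CBMS 93 (1997): §18.3–18.4.
* [MoeglinWaldspurger1995] C. Mœglin, J.-L. Waldspurger, *Spectral Decomposition and Eisenstein Series* (1995): II.1.7.
* [CasselsFrohlichANT1967] Cassels–Fröhlich (eds.), *Algebraic Number Theory* (1967): Ch. XV (Tate) Thm. 3.3.1.
-/

set_option autoImplicit false
-- the mandated namespace repeats the single-problem summit's segment (`HodgeConjecture.HodgeConjecture`)
set_option linter.dupNamespace false

noncomputable section

open scoped Matrix RestrictedProduct ENNReal NNReal Topology ComplexConjugate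
open NumberField IsDedekindDomain MeasureTheory Measure Filter Set

namespace Summit.HodgeConjecture.HodgeConjecture.Cruxes.HLiu418.K2LiuKindOneSingularTailOfRecord

open Literature.NumberTheory.Automorphic Literature.NumberTheory.GaloisRepresentations Literature.NumberTheory.LFunctions
open Literature.NumberTheory.GelbartRogawski1991 Literature.NumberTheory.GelbartRogawski1991.GRConstruction
open Literature.NumberTheory.GelbartRogawski1991.UnitaryDualPair
open Literature.NumberTheory.K2Lit.SiegelDoubled
open Literature.NumberTheory.K2Lit.PlaceSplitting
open Literature.MeasureTheory.RestrictedProduct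
open Literature.Topology.Algebra.RestrictedProduct (inH)
open Literature.NumberTheory.Automorphic.IdeleClassGroup (IsConjugateSymplectic toHeckeCharacter isUnitary_toHeckeCharacter)
open Summit.HodgeConjecture.HodgeConjecture.Cruxes.HLiu418.K2LiuSiegelUnipotentLocalDefs
open Summit.HodgeConjecture.HodgeConjecture.Cruxes.HLiu418.K2LiuSiegelUnipotentSplitDefs
open Summit.HodgeConjecture.HodgeConjecture.Cruxes.HLiu418.K2LiuSiegelUnipotentSplitAtDefs
open Summit.HodgeConjecture.HodgeConjecture.Cruxes.HLiu418.K2LiuSiegelUnipotentFourierDefs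
open Summit.HodgeConjecture.HodgeConjecture.Cruxes.HLiu418.K2LiuSiegelEisensteinKindWLetters
open Summit.HodgeConjecture.HodgeConjecture.Cruxes.HLiu418.K2LiuSiegelEisensteinKindWGlobalIntegrable (integrable_conj_unipDeltaChar_mul)
open Summit.HodgeConjecture.HodgeConjecture.Cruxes.HLiu418.K2LiuRankOneSingularLocalValueCMRecord
  (exists_finset_forall_integral_conjChar_lambdaLoc_weylDelta_eq_localScalarK1_of_record)
open Summit.HodgeConjecture.HodgeConjecture.Cruxes.HLiu418.K2LiuKindOneSingularTailEuler
  (whittakerDelta_eq_kindWPart_mul_scalarK1_mul_prod exists_cornerData_of_record kindWPart_slice_eq_sum_mul_prod)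

variable (L : Type) [Field L] [NumberField L] [IsCMField L]

section Head

variable {N M : ℕ} (e : Fin N × Fin M ≃ Fin 2)
  (dV : Fin N → L) (hdV : ∀ i, IsCMField.complexConj L (dV i) = dV i)
  (dW : Fin M → L) (hdW : ∀ i, IsCMField.complexConj L (dW i) = dW i)
  [DecidableEq (HeightOneSpectrum (𝓞 (Fp L)))]
  [MeasurableSpace ↥(unipDelta L e dV hdV dW hdW)] [BorelSpace ↥(unipDelta L e dV hdV dW hdW)]
  [MeasurableSpace ↥(unipDeltaArch L e dV hdV dW hdW)] [BorelSpace ↥(unipDeltaArch L e dV hdV dW hdW)]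
  [∀ v : HeightOneSpectrum (𝓞 (Fp L)), MeasurableSpace ↥(unipDeltaLoc L e dV hdV dW hdW v)] [∀ v : HeightOneSpectrum (𝓞 (Fp L)), BorelSpace ↥(unipDeltaLoc L e dV hdV dW hdW v)]

omit [NumberField L] [IsCMField L] in
/-- the K1-a♮ polynomial of record `s ↦ Σ_{k ≤ M} (ε · q^{1−2s})^k` is entire (`q ≠ 0`). [cite: Tan1999, §4 Prop. 4.8] -/
theorem differentiable_twistedPoly (ε : ℂ) {q : ℕ} (hq : q ≠ 0) (M' : ℕ) :
    Differentiable ℂ (fun s : ℂ => ∑ k ∈ Finset.range (M' + 1), (ε * (q : ℂ) ^ (1 - 2 * s)) ^ k) := by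
  have hc : Differentiable ℂ (fun s : ℂ => (q : ℂ) ^ (1 - 2 * s)) :=
    Differentiable.const_cpow (by fun_prop) (Or.inl (Nat.cast_ne_zero.2 hq))
  exact Differentiable.fun_sum fun k _ => ((differentiable_const ε).mul hc).pow k

set_option maxHeartbeats 800000 in -- MEASURED class of ★ (W1) ∕ ★ G1 ∕ ★ p862531 (the Whittaker–Euler data's `hmap` telescope and the two summand integrands in the statement); structural `rw`∕`exact` only
/-- **(K1a-T) THE SINGULAR TAIL OF RECORD — ★ p863404 §2 (ii)'s LETTERS `c D P hP Pm hPT HT htail I T q hq A W hsplit`, WITH WITNESS EQUATIONS.**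
DATA: the doubled CM datum of rank `2` (`hdV0 hdW0`), `lam` conjugate-symplectic, `f_s ∈ I_Δ(s, toHeckeCharacter L lam⁻¹)` continuous (`hsec hcont`; the socket's standard family
qualifies by `hstd.1.1`), a Haar measure `νN` on `N_Δ(𝔸)`, a real scalar `c₀` (the consumer's `(∫β)⁻¹`); the Whittaker–Euler data BY VALUE exactly as ★ (W1) (`T₀ νv hνK νinf hσ hmap`,
`hχ`; `hfac` with the slices `fT T s x := f s (placesEmbed T x)` EXPLICIT as ★ (KW-fac)); the Σ⊗ STRUCTURE of the slices in ★ (KW-fac)'s PLACE-INDEXED shape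
(`Finf j s a`, `Fv j v s y`, `hslice` for every `T ⊇ T₀` — ★ `exists_kindW_factorization` (3) pays it); per-FACTOR integrability on `{1 < re s}` at EVERY index and point
(`hintArch` — the KIND-W archimedean letter; `hintLoc` — ★ (iii-fin-int) `integrable_conj_unipDeltaChar_mul_of_isLocalSiegelSection` pays it for smooth local Siegel factors).
CONCLUSION: `∃ σc gc T D Pm mτ A W` such that — (a) corner transport: `W_S(f_s)(h) = W_{σc(S) E₁₁}(f_s)(gc S · h)` for rank-one `S`; (b) WITNESS EQUATIONS (the junction of record
for the localFace producers): `A S j s h = ∫ conj ψ_{σc(S)E₁₁}(ι_∞ a) · Finf j s ((w_Δ)_∞ · a · (gc S·h)_∞) dνinf(T S h)` and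
`W S j v s h = ∫ conj ψ_{σc(S)E₁₁}(ι_v y) · Fv j v s ((w_Δ)_v · y · (gc S·h)_v) dν_v`; (c) place-set letters: `T₀ ⊆ T S h`, `Pm S h` misses `T₀` (= `hPT` at `T'' := ↑T₀`),
`↑T₀ ∪ ↑(Pm S h) = ↑(T S h)`, `D S h` misses `T S h`; (d) `hq` (`q := residueCard`) and `hP` (the polynomials `Σ_{k≤mτ S v}(ε_v q_v^{1−2s})^k` are holomorphic on `{0 < re}`);
(e) **`htail ∘ hsplit`**: for rank-one `S`, `1 < re s`, every `h`,
`c₀ • W_S(f_s)(h) = c₀ · (Σ_j A S j s h · ∏_{v∈T S h} W S j v s h) · [ζ^{↑T₀∪↑Pm}_{L⁺}(2s) ∕ (ζ^{↑T₀∪↑Pm}_{L⁺}(2s+1)·L^{↑T₀∪↑Pm}(2s+2, ε_{L∕L⁺}))] · ∏_{v∈D S h} Σ_{k≤mτ S v}(ε_v q_v^{1−2s})^k`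
— i.e. ★ p863404 §2's `htail` (`c S h := c₀`, `HT S s h := Σ_j A·∏W`) and `hsplit` (`I S h := univ`, by `rfl`).  Proof: FILE 1 §2 ∘ FILE 1 §1 (at `T₀ ∪ T₁(σc S)`, `hI` := ★ p863366, `hG` := ★ (x-c))
∘ FILE 1 §3 (★ p862531 Fubini with the joint `hint` := ★ `integrable_tensor_prod_pi hintArch hintLoc`).
[cite: KudlaRallis1994, §2 (2.10)–(2.12)] [cite: Tan1999, §3; §4 Prop. 4.8] [cite: Shimura1997, §18.4] [cite: MoeglinWaldspurger1995, II.1.7] [cite: CasselsFrohlichANT1967, Ch. XV Thm. 3.3.1] -/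
theorem htail_hsplit_of_record (hdV0 : ∀ i, dV i ≠ 0) (hdW0 : ∀ i, dW i ≠ 0)
    {lam : IdeleClassGroup L →ₜ* Circle} (hlam : IsConjugateSymplectic L lam)
    {f : ℂ → HA L e dV hdV dW hdW → ℂ} (hsec : ∀ s : ℂ, IsSiegelDeltaSection L e dV hdV dW hdW (toHeckeCharacter L lam⁻¹) s (f s)) (hcont : ∀ s, Continuous (f s))
    (νN : Measure ↥(unipDelta L e dV hdV dW hdW)) [νN.IsHaarMeasure] (c₀ : ℝ)
    -- the Whittaker–Euler data BY VALUE (as ★ (W1)): bad set, local and archimedean carriers, the factorisation of `νN` at every `T`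
    (T₀ : Finset (HeightOneSpectrum (𝓞 (Fp L))))
    (νv : ∀ v : HeightOneSpectrum (𝓞 (Fp L)), Measure ↥(unipDeltaLoc L e dV hdV dW hdW v)) [∀ v, (νv v).IsHaarMeasure] [∀ v, SigmaFinite (νv v)]
    (hνK : ∀ v, νv v (((inH (fun v => UnitaryGroup.localInt L (IsCMField.complexConj L) (2 + 2) (hermD L e dV hdV dW hdW) v)
      (fun v => unipDeltaLoc L e dV hdV dW hdW v) v) : Subgroup ↥(unipDeltaLoc L e dV hdV dW hdW v)) : Set ↥(unipDeltaLoc L e dV hdV dW hdW v)) = 1)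
    (νinf : Finset (HeightOneSpectrum (𝓞 (Fp L))) → Measure ↥(unipDeltaArch L e dV hdV dW hdW)) (hσ : ∀ T, SigmaFinite (νinf T))
    (hmap : ∀ T : Finset (HeightOneSpectrum (𝓞 (Fp L))), Measure.map (unipDeltaSplitAt L e dV hdV dW hdW T) νN =
      (νinf T).prod ((Measure.pi fun v : T => νv v.1).prod
        (rpMeasure (fun v : {v : HeightOneSpectrum (𝓞 (Fp L)) // v ∉ T} => ((inH (fun v => UnitaryGroup.localInt L (IsCMField.complexConj L) (2 + 2) (hermD L e dV hdV dW hdW) v)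
          (fun v => unipDeltaLoc L e dV hdV dW hdW v) v.1 : Subgroup ↥(unipDeltaLoc L e dV hdV dW hdW v.1)) : Set ↥(unipDeltaLoc L e dV hdV dW hdW v.1))) (fun v => νv v.1) ∅)))
    (hχ : ∀ v, v ∉ T₀ → ∀ w' : UnitaryGroup.PlacesOver L v, (toHeckeCharacter L lam⁻¹).IsUnramifiedAt w'.1)
    (hfac : ∀ T : Finset (HeightOneSpectrum (𝓞 (Fp L))), T₀ ⊆ T →
      IsFactorizableOff L e dV hdV dW hdW T (toHeckeCharacter L lam⁻¹) f (fun s x => f s (placesEmbed L (hermD L e dV hdV dW hdW) T x)))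
    -- the Σ⊗ STRUCTURE of the slices, place-indexed (★ (KW-fac) `exists_kindW_factorization` (3)'s shape), ONE `m` for all `T ⊇ T₀`
    {m : ℕ} (Finf : Fin m → ℂ → UnitaryGroup.arch (Fp L) L (IsCMField.complexConj L) (2 + 2) (hermD L e dV hdV dW hdW) → ℂ)
    (Fv : Fin m → ∀ v : HeightOneSpectrum (𝓞 (Fp L)), ℂ → UnitaryGroup.localPi L (IsCMField.complexConj L) (2 + 2) (hermD L e dV hdV dW hdW) v → ℂ)
    (hslice : ∀ T : Finset (HeightOneSpectrum (𝓞 (Fp L))), T₀ ⊆ T →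
      ∀ (s : ℂ) (a : UnitaryGroup.arch (Fp L) L (IsCMField.complexConj L) (2 + 2) (hermD L e dV hdV dW hdW))
        (y : Π v : ↥T, UnitaryGroup.localPi L (IsCMField.complexConj L) (2 + 2) (hermD L e dV hdV dW hdW) v.1),
        f s (placesEmbed L (hermD L e dV hdV dW hdW) T (a, y)) = ∑ j, Finf j s a * ∏ v : ↥T, Fv j v.1 s (y v))
    -- per-FACTOR integrability on `{1 < re s}` at every index and every point: the archimedean letter (KIND-W `hintArch`) and the local letter (★ (iii-fin-int))
    (hintArch : ∀ (S' : Matrix (Fin 2) (Fin 2) L) (h' : HA L e dV hdV dW hdW) (T : Finset (HeightOneSpectrum (𝓞 (Fp L)))) (s : ℂ) (j : Fin m), 1 < s.re →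
      Integrable (fun a : ↥(unipDeltaArch L e dV hdV dW hdW) =>
        conj (unipDeltaChar L e dV hdV dW hdW S'
            (UnitaryGroup.archToAdelic (Fp L) L (IsCMField.complexConj L) (2 + 2) (hermD L e dV hdV dW hdW)
              (a : UnitaryGroup.arch (Fp L) L (IsCMField.complexConj L) (2 + 2) (hermD L e dV hdV dW hdW))) : ℂ) *
          Finf j s (UnitaryGroup.archPart (Fp L) L (IsCMField.complexConj L) (2 + 2) (hermD L e dV hdV dW hdW) (weylDelta L e dV hdV dW hdW) *
              (a : UnitaryGroup.arch (Fp L) L (IsCMField.complexConj L) (2 + 2) (hermD L e dV hdV dW hdW)) *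
              UnitaryGroup.archPart (Fp L) L (IsCMField.complexConj L) (2 + 2) (hermD L e dV hdV dW hdW) h')) (νinf T))
    (hintLoc : ∀ (S' : Matrix (Fin 2) (Fin 2) L) (h' : HA L e dV hdV dW hdW) (v : HeightOneSpectrum (𝓞 (Fp L))) (s : ℂ) (j : Fin m), 1 < s.re →
      Integrable (fun y : ↥(unipDeltaLoc L e dV hdV dW hdW v) =>
        conj (unipDeltaChar L e dV hdV dW hdW S'
            (locToAdelic L e dV hdV dW hdW v (y : UnitaryGroup.localPi L (IsCMField.complexConj L) (2 + 2) (hermD L e dV hdV dW hdW) v)) : ℂ) *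
          Fv j v s (UnitaryGroup.evalPlace (Fp L) L (IsCMField.complexConj L) (2 + 2) (hermD L e dV hdV dW hdW) v
                (UnitaryGroup.finPart (Fp L) L (IsCMField.complexConj L) (2 + 2) (hermD L e dV hdV dW hdW) (weylDelta L e dV hdV dW hdW)) *
              (y : UnitaryGroup.localPi L (IsCMField.complexConj L) (2 + 2) (hermD L e dV hdV dW hdW) v) *
              UnitaryGroup.evalPlace (Fp L) L (IsCMField.complexConj L) (2 + 2) (hermD L e dV hdV dW hdW) v
                (UnitaryGroup.finPart (Fp L) L (IsCMField.complexConj L) (2 + 2) (hermD L e dV hdV dW hdW) h'))) (νv v)) :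
    ∃ (σc : skewMatrices ((IsCMField.complexConj L : L ≃ₐ[Fp L] L) : L →+* L) ((gramR L e dV hdV dW hdW).map (algebraMap (Fp L) L)) → L)
      (gc : skewMatrices ((IsCMField.complexConj L : L ≃ₐ[Fp L] L) : L →+* L) ((gramR L e dV hdV dW hdW).map (algebraMap (Fp L) L)) → HA L e dV hdV dW hdW)
      (T D Pm : skewMatrices ((IsCMField.complexConj L : L ≃ₐ[Fp L] L) : L →+* L) ((gramR L e dV hdV dW hdW).map (algebraMap (Fp L) L)) → HA L e dV hdV dW hdW →
        Finset (HeightOneSpectrum (𝓞 (Fp L))))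
      (mτ : skewMatrices ((IsCMField.complexConj L : L ≃ₐ[Fp L] L) : L →+* L) ((gramR L e dV hdV dW hdW).map (algebraMap (Fp L) L)) → HeightOneSpectrum (𝓞 (Fp L)) → ℕ)
      (A : skewMatrices ((IsCMField.complexConj L : L ≃ₐ[Fp L] L) : L →+* L) ((gramR L e dV hdV dW hdW).map (algebraMap (Fp L) L)) → Fin m → ℂ → HA L e dV hdV dW hdW → ℂ)
      (W : skewMatrices ((IsCMField.complexConj L : L ≃ₐ[Fp L] L) : L →+* L) ((gramR L e dV hdV dW hdW).map (algebraMap (Fp L) L)) → Fin m →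
        HeightOneSpectrum (𝓞 (Fp L)) → ℂ → HA L e dV hdV dW hdW → ℂ),
      -- (a) the corner transport (★ (K1a-1), letters discharged in §2)
      (∀ S : skewMatrices ((IsCMField.complexConj L : L ≃ₐ[Fp L] L) : L →+* L) ((gramR L e dV hdV dW hdW).map (algebraMap (Fp L) L)),
        (S : Matrix (Fin 2) (Fin 2) L) ≠ 0 → (S : Matrix (Fin 2) (Fin 2) L).det = 0 → ∀ (s : ℂ) (h : HA L e dV hdV dW hdW),
          whittakerDelta L e dV hdV dW hdW νN (S : Matrix (Fin 2) (Fin 2) L) (f s) h =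
            whittakerDelta L e dV hdV dW hdW νN (Matrix.single 1 1 (σc S)) (f s) (gc S * h)) ∧
      -- (b) WITNESS EQUATIONS: the raw archimedean ∕ local twisted integrals of the `j`-th pure tensor at the corner index and the translate (the localFace junction of record)
      (∀ (S : skewMatrices ((IsCMField.complexConj L : L ≃ₐ[Fp L] L) : L →+* L) ((gramR L e dV hdV dW hdW).map (algebraMap (Fp L) L))) (j : Fin m) (s : ℂ) (h : HA L e dV hdV dW hdW),
        A S j s h = ∫ a, conj (unipDeltaChar L e dV hdV dW hdW (Matrix.single 1 1 (σc S))
            (UnitaryGroup.archToAdelic (Fp L) L (IsCMField.complexConj L) (2 + 2) (hermD L e dV hdV dW hdW)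
              (a : UnitaryGroup.arch (Fp L) L (IsCMField.complexConj L) (2 + 2) (hermD L e dV hdV dW hdW))) : ℂ) *
          Finf j s (UnitaryGroup.archPart (Fp L) L (IsCMField.complexConj L) (2 + 2) (hermD L e dV hdV dW hdW) (weylDelta L e dV hdV dW hdW) *
              (a : UnitaryGroup.arch (Fp L) L (IsCMField.complexConj L) (2 + 2) (hermD L e dV hdV dW hdW)) *
              UnitaryGroup.archPart (Fp L) L (IsCMField.complexConj L) (2 + 2) (hermD L e dV hdV dW hdW) (gc S * h)) ∂(νinf (T S h))) ∧
      (∀ (S : skewMatrices ((IsCMField.complexConj L : L ≃ₐ[Fp L] L) : L →+* L) ((gramR L e dV hdV dW hdW).map (algebraMap (Fp L) L))) (j : Fin m)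
        (v : HeightOneSpectrum (𝓞 (Fp L))) (s : ℂ) (h : HA L e dV hdV dW hdW),
        W S j v s h = ∫ y, conj (unipDeltaChar L e dV hdV dW hdW (Matrix.single 1 1 (σc S))
            (locToAdelic L e dV hdV dW hdW v (y : UnitaryGroup.localPi L (IsCMField.complexConj L) (2 + 2) (hermD L e dV hdV dW hdW) v)) : ℂ) *
          Fv j v s (UnitaryGroup.evalPlace (Fp L) L (IsCMField.complexConj L) (2 + 2) (hermD L e dV hdV dW hdW) v
                (UnitaryGroup.finPart (Fp L) L (IsCMField.complexConj L) (2 + 2) (hermD L e dV hdV dW hdW) (weylDelta L e dV hdV dW hdW)) *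
              (y : UnitaryGroup.localPi L (IsCMField.complexConj L) (2 + 2) (hermD L e dV hdV dW hdW) v) *
              UnitaryGroup.evalPlace (Fp L) L (IsCMField.complexConj L) (2 + 2) (hermD L e dV hdV dW hdW) v
                (UnitaryGroup.finPart (Fp L) L (IsCMField.complexConj L) (2 + 2) (hermD L e dV hdV dW hdW) (gc S * h))) ∂(νv v)) ∧
      -- (c) place-set letters: `T₀ ⊆ T S h`; `Pm S h ∩ T₀ = ∅` (★ p863404's `hPT` at `T'' := ↑T₀`); `↑T₀ ∪ ↑(Pm S h) = ↑(T S h)`; `D S h ∩ T S h = ∅`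
      (∀ S (h : HA L e dV hdV dW hdW), T₀ ⊆ T S h) ∧
      (∀ S (h : HA L e dV hdV dW hdW), ∀ v ∈ Pm S h, v ∉ (T₀ : Set (HeightOneSpectrum (𝓞 (Fp L))))) ∧
      (∀ S (h : HA L e dV hdV dW hdW), (T₀ : Set (HeightOneSpectrum (𝓞 (Fp L)))) ∪ (Pm S h : Set (HeightOneSpectrum (𝓞 (Fp L)))) = (T S h : Set (HeightOneSpectrum (𝓞 (Fp L))))) ∧
      (∀ S (h : HA L e dV hdV dW hdW), ∀ v ∈ D S h, v ∉ T S h) ∧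
      -- (d) `hq` (`q := residueCard`) and `hP` (★ p863404's binders)
      (∀ S (h : HA L e dV hdV dW hdW), ∀ v ∈ T S h, v.residueCard ≠ 0) ∧
      (∀ S : skewMatrices ((IsCMField.complexConj L : L ≃ₐ[Fp L] L) : L →+* L) ((gramR L e dV hdV dW hdW).map (algebraMap (Fp L) L)),
        (S : Matrix (Fin 2) (Fin 2) L) ≠ 0 → (S : Matrix (Fin 2) (Fin 2) L).det = 0 → ∀ (h : HA L e dV hdV dW hdW), ∀ v ∈ D S h,
          DifferentiableOn ℂ (fun s : ℂ => ∑ k ∈ Finset.range (mτ S v + 1), ((quadraticHeckeCharCM L).valueAtUniformizer v * (v.residueCard : ℂ) ^ (1 - 2 * s)) ^ k)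
            {s : ℂ | 0 < s.re}) ∧
      -- (e) `htail ∘ hsplit`: the singular tail of record
      (∀ S : skewMatrices ((IsCMField.complexConj L : L ≃ₐ[Fp L] L) : L →+* L) ((gramR L e dV hdV dW hdW).map (algebraMap (Fp L) L)),
        (S : Matrix (Fin 2) (Fin 2) L) ≠ 0 → (S : Matrix (Fin 2) (Fin 2) L).det = 0 → ∀ (s : ℂ) (h : HA L e dV hdV dW hdW), 1 < s.re →
          (c₀ : ℝ) • whittakerDelta L e dV hdV dW hdW νN (S : Matrix (Fin 2) (Fin 2) L) (f s) h =
            (c₀ : ℂ) * (∑ j, A S j s h * ∏ v ∈ T S h, W S j v s h) *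
              (partialStandardL ((T₀ : Set (HeightOneSpectrum (𝓞 (Fp L)))) ∪ (Pm S h : Set (HeightOneSpectrum (𝓞 (Fp L))))) (fun _ => {1}) (2 * s) /
                (partialStandardL ((T₀ : Set (HeightOneSpectrum (𝓞 (Fp L)))) ∪ (Pm S h : Set (HeightOneSpectrum (𝓞 (Fp L))))) (fun _ => {1}) (2 * s + 1) *
                  partialStandardL ((T₀ : Set (HeightOneSpectrum (𝓞 (Fp L)))) ∪ (Pm S h : Set (HeightOneSpectrum (𝓞 (Fp L)))))
                    (fun v => {(quadraticHeckeCharCM L).valueAtUniformizer v}) (2 * s + 2))) *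
              ∏ v ∈ D S h, ∑ k ∈ Finset.range (mτ S v + 1), ((quadraticHeckeCharCM L).valueAtUniformizer v * (v.residueCard : ℂ) ^ (1 - 2 * s)) ^ k) := by
  classical
  have hχu : (toHeckeCharacter L lam⁻¹).IsUnitary := isUnitary_toHeckeCharacter L lam⁻¹
  -- FILE 1 §2: the corner data of record
  obtain ⟨σc, gc, hcorner⟩ := exists_cornerData_of_record L e dV hdV dW hdW hdV0 hdW0
  -- ★ p863366's exceptional set at `σ := σc S` (vacuous off rank one)
  have hloc : ∀ S : skewMatrices ((IsCMField.complexConj L : L ≃ₐ[Fp L] L) : L →+* L) ((gramR L e dV hdV dW hdW).map (algebraMap (Fp L) L)),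
      ∃ T₁ : Finset (HeightOneSpectrum (𝓞 (Fp L))), (S : Matrix (Fin 2) (Fin 2) L) ≠ 0 → (S : Matrix (Fin 2) (Fin 2) L).det = 0 → ∀ v ∉ T₁,
        ∀ (ν : Measure ↥(unipDeltaLoc L e dV hdV dW hdW v)) [ν.IsHaarMeasure],
          ν (((inH (fun v => UnitaryGroup.localInt L (IsCMField.complexConj L) (2 + 2) (hermD L e dV hdV dW hdW) v) (fun v => unipDeltaLoc L e dV hdV dW hdW v) v) :
            Subgroup ↥(unipDeltaLoc L e dV hdV dW hdW v)) : Set ↥(unipDeltaLoc L e dV hdV dW hdW v)) = 1 →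
          ∀ s : ℂ, 1 < s.re →
            ∫ y, conj ((unipDeltaChar L e dV hdV dW hdW (Matrix.single 1 1 (σc S)) (locToAdelic L e dV hdV dW hdW v (y : UnitaryGroup.localPi L (IsCMField.complexConj L) (2 + 2) (hermD L e dV hdV dW hdW) v)) : Circle) : ℂ) * LambdaLoc L e dV hdV dW hdW v (toHeckeCharacter L lam⁻¹) s (UnitaryGroup.evalPlace (Fp L) L (IsCMField.complexConj L) (2 + 2) (hermD L e dV hdV dW hdW) v (UnitaryGroup.finPart (Fp L) L (IsCMField.complexConj L) (2 + 2) (hermD L e dV hdV dW hdW) (weylDelta L e dV hdV dW hdW)) * (y : UnitaryGroup.localPi L (IsCMField.complexConj L) (2 + 2) (hermD L e dV hdV dW hdW) v)) ∂ν =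
              (1 - (v.residueCard : ℂ) ^ (-(2 * s + 1))) * (1 - (quadraticHeckeCharCM L).valueAtUniformizer v * (v.residueCard : ℂ) ^ (-(2 * s + 2))) /
            (1 - (v.residueCard : ℂ) ^ (-(2 * s))) *
            ∑ k ∈ Finset.range ((-WithZero.log (Valued.v (algebraMap (Fp L) (v.adicCompletion (Fp L)) (gramR L e dV hdV dW hdW 1 1 * Algebra.trace (Fp L) L (σc S * imagUnit L))))).toNat + 1), ((quadraticHeckeCharCM L).valueAtUniformizer v * (v.residueCard : ℂ) ^ (1 - 2 * s)) ^ k := by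
    intro S
    by_cases hr : (S : Matrix (Fin 2) (Fin 2) L) ≠ 0 ∧ (S : Matrix (Fin 2) (Fin 2) L).det = 0
    · obtain ⟨T₁, hT₁⟩ := exists_finset_forall_integral_conjChar_lambdaLoc_weylDelta_eq_localScalarK1_of_record L e dV hdV dW hdW hdV0 hdW0 hlam (σc S)
        (hcorner S hr.1 hr.2).1
      exact ⟨T₁, fun _ _ => hT₁⟩
    · exact ⟨∅, fun h0 hd => absurd ⟨h0, hd⟩ hr⟩
  choose Tσ hTσ using hloc
  -- the exponents `mτ S v = ord_v τ(σc S)` vanish off a finite set (`|ι_v τ|_v = 1` cofinitely)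
  have hsupp : ∀ S : skewMatrices ((IsCMField.complexConj L : L ≃ₐ[Fp L] L) : L →+* L) ((gramR L e dV hdV dW hdW).map (algebraMap (Fp L) L)),
      ∃ Dτ : Finset (HeightOneSpectrum (𝓞 (Fp L))), (S : Matrix (Fin 2) (Fin 2) L) ≠ 0 → (S : Matrix (Fin 2) (Fin 2) L).det = 0 → ∀ v ∉ Dτ,
        Valued.v (algebraMap (Fp L) (v.adicCompletion (Fp L)) (gramR L e dV hdV dW hdW 1 1 * Algebra.trace (Fp L) L (σc S * imagUnit L))) = 1 := by
    intro S
    by_cases hr : (S : Matrix (Fin 2) (Fin 2) L) ≠ 0 ∧ (S : Matrix (Fin 2) (Fin 2) L).det = 0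
    · refine ⟨(Filter.eventually_cofinite.1 (UnitaryGroup.eventually_valued_algebraMap_eq_one (Fp L) (hcorner S hr.1 hr.2).1)).toFinset, fun _ _ v hv => ?_⟩
      by_contra h1
      exact hv ((Set.Finite.mem_toFinset _).2 h1)
    · exact ⟨∅, fun h0 hd => absurd ⟨h0, hd⟩ hr⟩
  choose Dτ hDτ using hsupp
  -- THE WITNESSES
  refine ⟨σc, gc,
    fun S h => kindWFinset L e dV hdV dW hdW (T₀ ∪ Tσ S) (Matrix.single 1 1 (σc S)) (gc S * h),
    fun S h => (Dτ S).filter (fun v => v ∉ kindWFinset L e dV hdV dW hdW (T₀ ∪ Tσ S) (Matrix.single 1 1 (σc S)) (gc S * h)),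
    fun S h => kindWFinset L e dV hdV dW hdW (T₀ ∪ Tσ S) (Matrix.single 1 1 (σc S)) (gc S * h) \ T₀,
    fun S v => (-WithZero.log (Valued.v (algebraMap (Fp L) (v.adicCompletion (Fp L)) (gramR L e dV hdV dW hdW 1 1 * Algebra.trace (Fp L) L (σc S * imagUnit L))))).toNat,
    fun S j s h => ∫ a, conj (unipDeltaChar L e dV hdV dW hdW (Matrix.single 1 1 (σc S))
            (UnitaryGroup.archToAdelic (Fp L) L (IsCMField.complexConj L) (2 + 2) (hermD L e dV hdV dW hdW)
              (a : UnitaryGroup.arch (Fp L) L (IsCMField.complexConj L) (2 + 2) (hermD L e dV hdV dW hdW))) : ℂ) *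
          Finf j s (UnitaryGroup.archPart (Fp L) L (IsCMField.complexConj L) (2 + 2) (hermD L e dV hdV dW hdW) (weylDelta L e dV hdV dW hdW) *
              (a : UnitaryGroup.arch (Fp L) L (IsCMField.complexConj L) (2 + 2) (hermD L e dV hdV dW hdW)) *
              UnitaryGroup.archPart (Fp L) L (IsCMField.complexConj L) (2 + 2) (hermD L e dV hdV dW hdW) (gc S * h))
          ∂(νinf (kindWFinset L e dV hdV dW hdW (T₀ ∪ Tσ S) (Matrix.single 1 1 (σc S)) (gc S * h))),
    fun S j v s h => ∫ y, conj (unipDeltaChar L e dV hdV dW hdW (Matrix.single 1 1 (σc S))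
            (locToAdelic L e dV hdV dW hdW v (y : UnitaryGroup.localPi L (IsCMField.complexConj L) (2 + 2) (hermD L e dV hdV dW hdW) v)) : ℂ) *
          Fv j v s (UnitaryGroup.evalPlace (Fp L) L (IsCMField.complexConj L) (2 + 2) (hermD L e dV hdV dW hdW) v
                (UnitaryGroup.finPart (Fp L) L (IsCMField.complexConj L) (2 + 2) (hermD L e dV hdV dW hdW) (weylDelta L e dV hdV dW hdW)) *
              (y : UnitaryGroup.localPi L (IsCMField.complexConj L) (2 + 2) (hermD L e dV hdV dW hdW) v) *
              UnitaryGroup.evalPlace (Fp L) L (IsCMField.complexConj L) (2 + 2) (hermD L e dV hdV dW hdW) v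
                (UnitaryGroup.finPart (Fp L) L (IsCMField.complexConj L) (2 + 2) (hermD L e dV hdV dW hdW) (gc S * h))) ∂(νv v),
    fun S hS0 hdet s h => (hcorner S hS0 hdet).2 νN (toHeckeCharacter L lam⁻¹) s (f s) (hsec s) h,
    fun _ _ _ _ => rfl, fun _ _ _ _ _ => rfl,
    fun S h => Finset.subset_union_left.trans (subset_kindWFinset L e dV hdV dW hdW _ _ _),
    fun S h v hv => fun hv0 => (Finset.mem_sdiff.1 hv).2 (Finset.mem_coe.1 hv0),
    fun S h => ?_, fun S h v hv => (Finset.mem_filter.1 hv).2,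
    fun S h v _ => by have := v.one_lt_residueCard; omega,
    fun S _ _ h v _ => (differentiable_twistedPoly _ (by have := v.one_lt_residueCard; omega) _).differentiableOn,
    fun S hS0 hdet s h hs => ?_⟩
  · -- `↑T₀ ∪ ↑(T S h ∖ T₀) = ↑(T S h)` since `T₀ ⊆ T S h`
    rw [Finset.coe_sdiff, Set.union_sdiff_self, Set.union_eq_right]
    exact Finset.coe_subset.2 (Finset.subset_union_left.trans (subset_kindWFinset L e dV hdV dW hdW _ _ _))
  · -- (e) THE TAIL: §2 corner transport, §1 at `T₀ ∪ T₁(σc S)` (`hI` ★ p863366, `hG` ★ (x-c)), ★ p862531 Fubini with `hint` := ★ `integrable_tensor_prod_pi`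
    obtain ⟨hτ0, htrans⟩ := hcorner S hS0 hdet
    have hs' : 1 / 2 < s.re := by linarith
    have hs2 : ((2 : ℕ) : ℝ) / 2 < s.re := by norm_num; exact hs
    have hsub : T₀ ⊆ kindWFinset L e dV hdV dW hdW (T₀ ∪ Tσ S) (Matrix.single 1 1 (σc S)) (gc S * h) :=
      Finset.subset_union_left.trans (subset_kindWFinset L e dV hdV dW hdW _ _ _)
    -- FILE 1 §1 at the corner index and the translate
    have h1 := whittakerDelta_eq_kindWPart_mul_scalarK1_mul_prod L e dV hdV dW hdW (T₀ ∪ Tσ S) νN νv hνK νinf hσ hmap (χ := toHeckeCharacter L lam⁻¹)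
      (fun v hv w' => hχ v (fun h0 => hv (Finset.mem_union_left _ h0)) w')
      (fT := fun T s x => f s (placesEmbed L (hermD L e dV hdV dW hdW) T x)) (fun T hT => hfac T (Finset.subset_union_left.trans hT))
      (Matrix.single 1 1 (σc S)) hs' (gc S * h)
      (integrable_conj_unipDeltaChar_mul L e dV hdV dW hdW hdV0 hdW0 hχu hs2 (hsec s) (hcont s) νN (Matrix.single 1 1 (σc S)) (gc S * h))
      (fun v => (-WithZero.log (Valued.v (algebraMap (Fp L) (v.adicCompletion (Fp L)) (gramR L e dV hdV dW hdW 1 1 * Algebra.trace (Fp L) L (σc S * imagUnit L))))).toNat)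
      (Dτ S) (fun v hv => by rw [hDτ S hS0 hdet v hv, WithZero.log_one, neg_zero, Int.toNat_zero])
      (fun v hv => hTσ S hS0 hdet v (fun hvT => hv (subset_kindWPlaces L e dV hdV dW hdW (Finset.mem_coe.2 (Finset.mem_union_right _ hvT))))
        (νv v) (hνK v) s hs)
    -- FILE 1 §3: the head `I_U` IS the Σ∏ of the witnesses (★ p862531 Fubini, joint `hint` from the two factor letters)
    haveI := hσ (kindWFinset L e dV hdV dW hdW (T₀ ∪ Tσ S) (Matrix.single 1 1 (σc S)) (gc S * h))
    have h3 := kindWPart_slice_eq_sum_mul_prod L e dV hdV dW hdW (kindWFinset L e dV hdV dW hdW (T₀ ∪ Tσ S) (Matrix.single 1 1 (σc S)) (gc S * h))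
      (νinf (kindWFinset L e dV hdV dW hdW (T₀ ∪ Tσ S) (Matrix.single 1 1 (σc S)) (gc S * h))) νv Finf Fv (hslice _ hsub)
      (Matrix.single 1 1 (σc S)) s (gc S * h) (fun j => hintArch _ _ _ s j hs) (fun j v => hintLoc _ _ v.1 s j hs)
    -- assemble: `c₀ • W_S = c₀ · W_{S♭}(h′) = c₀ · (I_U · sc¹^U · ∏ P)`, `U = ↑T₀ ∪ ↑Pm`
    have hU : kindWPlaces L e dV hdV dW hdW ((T₀ ∪ Tσ S : Finset (HeightOneSpectrum (𝓞 (Fp L)))) : Set (HeightOneSpectrum (𝓞 (Fp L))))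
        (Matrix.single 1 1 (σc S)) (gc S * h) =
        (T₀ : Set (HeightOneSpectrum (𝓞 (Fp L)))) ∪
          ((kindWFinset L e dV hdV dW hdW (T₀ ∪ Tσ S) (Matrix.single 1 1 (σc S)) (gc S * h) \ T₀ : Finset (HeightOneSpectrum (𝓞 (Fp L)))) :
            Set (HeightOneSpectrum (𝓞 (Fp L)))) := by
      rw [Finset.coe_sdiff, Set.union_sdiff_self, Set.union_eq_right.2 (Finset.coe_subset.2 hsub), coe_kindWFinset]
    beta_reduce
    rw [Complex.real_smul, htrans νN (toHeckeCharacter L lam⁻¹) s (f s) (hsec s) h, h1, hU, h3]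
    ring


end Head

end Summit.HodgeConjecture.HodgeConjecture.Cruxes.HLiu418.K2LiuKindOneSingularTailOfRecord

end
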